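import Summits.HodgeConjecture.HodgeCM.PerL34.ArchAWeil_1

/-! PORT of `HodgeCM/PerL34/ArchAWeil.lean` (HodgeCMPerL run 82) — part 2: continuation of `Summits.HodgeConjecture.HodgeCM.PerL34.ArchAWeil_1` (split at a top-level declaration boundary by port_pkg.py; scope re-opened below; declarations unchanged). -/

-- port_pkg: scope re-opened for this part (file-level context, then the namespace/section stack open at the cut)
set_option autoImplicit false
noncomputable section
open MeasureTheory Topology
attribute [-instance] Quotient.instMeasurableSpace
namespace HodgeCM
namespace PerL34
namespace ArchAWeil
open ArchA
section LineDatum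
variable {GU : Type} [Group GU] [TopologicalSpace GU] [IsTopologicalGroup GU] {ΓU : Subgroup GU}
variable {G : Type} [CommGroup G] [TopologicalSpace G] [IsTopologicalGroup G] {Γ : Subgroup G}
variable [CompactSpace (GU ⧸ ΓU)] [CompactSpace (G ⧸ Γ)] [MeasurableSpace (G ⧸ Γ)] [BorelSpace (G ⧸ Γ)]
variable (M : WeilThetaModel GU ΓU G Γ) {RealPl : Type} (ι₁ : RealPl) (ι : RealPl → (Circle →* G))
  (kJ : RealPl → ℤ)
/-- `WeightDecomposition` needs checking on the generators `θ_Φ`, `Φ ∈ 𝒮^κ`, only. -/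
theorem weightDecomposition_of_generators
    (h : ∀ (b : RealPl) (Φ : M.SK),
      (⟨M.θ Φ, θ_mem_kerSpan M Φ⟩ : kerSpan M) ∈ ⨆ k, (lineData M ι₁ ι kJ).piece b k) :
    (lineData M ι₁ ι kJ).WeightDecomposition := by
  intro b
  refine eq_top_iff.mpr fun F _ => ?_
  have hle : kerSpan M ≤ (⨆ k, (lineData M ι₁ ι kJ).piece b k).map (kerSpan M).subtype := by
    change Submodule.span ℂ (Set.range M.θ) ≤ _
    refine Submodule.span_le.mpr ?_
    rintro _ ⟨Φ, rfl⟩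
    exact ⟨⟨M.θ Φ, θ_mem_kerSpan M Φ⟩, h b Φ, rfl⟩
  obtain ⟨F', hF', hFF'⟩ := Submodule.mem_map.mp (hle F.2)
  have hF : F' = F := Subtype.ext hFF'
  exact hF ▸ hF'

/-- A kernel `θ_Ψ` on which `U(W_{i,b})` acts by `u ↦ u^k` lies in the weight space `piece b k`. -/
theorem θ_mem_piece {b : RealPl} {Ψ : M.SK} {k : ℤ}
    (hΨ : ∀ u : Circle, M.θ (M.omg (ι b u) Ψ) = ((u : ℂ) ^ k) • M.θ Ψ) :
    (⟨M.θ Ψ, θ_mem_kerSpan M Ψ⟩ : kerSpan M) ∈ (lineData M ι₁ ι kJ).piece b k := by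
  refine (Submodule.mem_iInf _).mpr fun u => Module.End.mem_eigenspace_iff.mpr (Subtype.ext ?_)
  change transl (ι b u) (M.θ Ψ) =
    ((((u : ℂ) ^ k) • (⟨M.θ Ψ, θ_mem_kerSpan M Ψ⟩ : kerSpan M) : kerSpan M) : C((GU ⧸ ΓU) × (G ⧸ Γ), ℂ))
  rw [Submodule.coe_smul, transl_θ]
  exact hΨ u

/-- **The PRINT input on the model implies N27's `WeightDecomposition`** for the line datum. -/
theorem weightDecomposition_of_kernel (h : KernelWeightDecomposition M ι) :
    (lineData M ι₁ ι kJ).WeightDecomposition := by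
  refine weightDecomposition_of_generators M ι₁ ι kJ fun b Φ => ?_
  obtain ⟨n, Ψ, k, hsum, hΨ⟩ := h b Φ
  have heq : (⟨M.θ Φ, θ_mem_kerSpan M Φ⟩ : kerSpan M) =
      ∑ j, (⟨M.θ (Ψ j), θ_mem_kerSpan M (Ψ j)⟩ : kerSpan M) :=
    Subtype.ext (by rw [Submodule.coe_sum]; exact hsum)
  rw [heq]
  exact Submodule.sum_mem _ fun j _ => Submodule.mem_iSup_of_mem (k j) (θ_mem_piece M ι₁ ι kJ (hΨ j))

/-- The equivariance of tex l. 493, `θ(ω(u)φ, χ') = χ'(u)⁻¹ θ(φ, χ')` (`u ∈ U(W_{i,b})`), hypothesis-free in this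
model (pv02's `lift_act` with `ThetaKernel` discharged). -/
theorem lift_act_ofWeil (χ : ContinuousMonoidHom (G ⧸ Γ) Circle) (b : RealPl) (u : Circle) (F : kerSpan M) :
    (lineData M ι₁ ι kJ).lift χ (omega M (ι b u) F) =
      ((χ ((ι b u : G) : G ⧸ Γ) : ℂ)⁻¹) • (lineData M ι₁ ι kJ).lift χ F :=
  LineArchData.lift_act (thetaKernel M ι₁ ι kJ) χ b u F

/-- **N27 = PerL v5 Lemma 4.1(a) over the Weil theta model**, from pv02's `N27_of` with `ThetaKernel` and
`WeightAction` DISCHARGED: the one remaining input is the PRINT fact `WeightDecomposition` ([BW] VIII 2.7(1) /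
2.8(1): every `θ_Φ`, `Φ ∈ 𝒮^κ`, is a finite sum of `U(W_{i,b})`-weight kernels at each real place). -/
theorem N27_ofWeil (hD : (lineData M ι₁ ι kJ).WeightDecomposition) : (lineData M ι₁ ι kJ).N27_statement :=
  LineArchData.N27_of (thetaKernel M ι₁ ι kJ) (weightAction M ι₁ ι kJ) hD

/-- **N27 over the Weil theta model, NET FORM**: hypotheses = the model `M` (prl1-g4: [We64] n° 39 / Thm 6 BY
NAME + class-U splitting), the DATA `ι` (real-place circles `U(W_{i,b}) →* U(W_i)(𝔸)`), `kJ` ([BW] weight names,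
as in `ArchA`/`ArchAFockModel`), and ONE PRINT input `KernelWeightDecomposition M ι` ([BW] VIII 2.7(1)); the
statement is pv02's VERBATIM rendering `N27_statement` of PerL v5 Lemma 4.1(a) for the line datum. -/
theorem N27_ofWeilModel (h : KernelWeightDecomposition M ι) : (lineData M ι₁ ι kJ).N27_statement :=
  N27_ofWeil M ι₁ ι kJ (weightDecomposition_of_kernel M ι₁ ι kJ h)

end LineDatum

end ArchAWeil
end PerL34
end HodgeCM

end
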